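import Summits.Schanuel.Schanuel.Theorems.RootDecomp1KSiegelFunctionsAll01

/-!
# RootDecomp1KSiegelFunctionsAll (part 02 of 03) — CENSUS PROVENANCE for lens-1 g71 NODE 31-G «SiegelFunctionsAll and the height binder HeightComparison PROVED hypothesis-free» (FLOOR G (a) of RULE K-R59 (ii); CLAIM 31-G L3188, NOTES L3189 / L3190 / L3193 (v3c digests of record); crit-1 (g13) VERDICT 31-G L3194: FLOOR G (a) CONTENT MET IN SCRATCH — THEOREM ×1 PAYABLE ON LANDING, PORT GO)

(census-1 g26 record port. SOURCE: the lens's standalone HOME/decomp-schanuel-lens-1/g71/out/SiegelFunctionsAll.lean v3c sha256 e1ade63183dfe401… (804 l; = PlanG b3685036… on top of the LANDED tree port RootDecomp1KSiegelFunctions01–09 = K 4f39c136…, PORT LANDED 31 L3184, PORT IDENTITY 31 L3187) split BY THE LENS into portG/RootDecomp1KSiegelFunctionsAll01 69e9e04cfd00… (341 l) / 02 444c4e5c0a50… (314 l) / 03 20ceda62193a… (213 l), cum 3340325d… rc 0 · 0 sorries (lens farm; NOTE L3193); the critic re-checked v3 / v3c rc 0 · 0 sorries, `--axioms` standard on the heads,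 CONTROL ControlG rc 1 as designed (VERDICT 31-G (i)–(v)). The census takes the three lens parts as the bodies (the nested sections PlanG ⊃ S5 ⊃ Main are re-opened per part by the lens; the `attribute [instance]` line on the bundled-structure fields CurveModel.instField / .instAlgebra / .instAFF in part 01 is the lens's — the gate routes it to review), adding this provenance block, one-line docstrings for undocumented helpers (part 01: 6; statements quoted), and THREE PORT-SIDE MODIFIERS OF RECORD asked for / forced by the gate: (m1) part 01 `curveModel_nonempty`: the DEPRECATED `IsLocalization.integerNormalization_map_to_map` replaced by `IsLocalization.integerNormalization_spec` (b : K[X] with b ∈ M; three tokens adapted; VERDICT 31-G PORT GO «fix the two lint warnings»); (m2) part 02 `mem_of_ord_nonneg`: `omit [IsAlgFunctionField K F] in` (unused section variable); (m3) `exists_map_eq_C_mul` PRIVATE in part 01 (dedup.landed dry-run notice ≡ `Literature.NumberTheory.LFunctions.WeilFatou.exists_int_map_eq_C_mul`) with a PRIVATE copy in part 02 for `integralDegreeBound`; everything else = the lens's parts VERBATIM. Chain 01 ← …RootDecomp1KSiegelFunctions09 + Literature…PlaneCurveFunctionFieldProofs / FunctionFieldGenusRatPlacesProofs / FunctionFieldGenusProofs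 / FunctionFieldGenusRiemannTheoremProofs + Mathlib.RingTheory.Spectrum.Maximal.Localization / Mathlib.RingTheory.DedekindDomain.IntegralClosure, 02 ← 01, 03 ← 02; ONE namespace Summit.Schanuel.Schanuel.Theorems.RootDecomp1KSiegelFunctions (the node-31 namespace, extended); `--supports stmt-Schanuel-33364` (item OPEN; the heads decide no ∀-item of the route). HEADS (part 03): `theorem siegelFunctionsAll : SiegelFunctionsAll` and `theorem heightComparison : RootDecomp1KHeightGrading.HeightComparison` — node 12's (β) print binder DISCHARGED in the tree, hypothesis-free — via S1/S6a `curveModel_nonempty` / `modelExists`, S2 `degYBound` (part 01), S5 `integralDegreeBound` (part 02: valuation-integrality + `minpoly_map_eq_of_forall_mem` + `scaleRoots` over K(x) = K(1/x) + transcendence degree count), S6b `qdvd_relPoly_of_rel`, S3/S4 by the Literature Riemann inequality `degree_add_one_sub_ell_le_genus_holds` BY NAME, the compositions `siegelFunctions_of_model` / `siegelFunctionsAll_of` / `siegelFunctionsAll_of_integralDegreeBound` / `heightComparison_of_integralDegreeBound`; the eight ×0 corollaries `heightComparisonAt_of_geomIrreducible`, `thinFibreAt_of_geomIrreducible` (node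 12's THEOREM A unconditional), `thinFibre_of_padicSubspace` (the K-line sector head with the height binder gone: PadicSubspace ∧ HeightOffAt m₀ ⇒ ThinFibre m₀), `b_of_padicSubspace`, `thinFibreAt_iff_levelFinite_of_lt` / `thinFibreAt_iff_bddLevelEmpty_of_lt` (THEOREM B unconditional), `thinFibreAt_grading_of_geomIrreducible`, `thinFibreAt_of_heightDecided`. VERDICT 31-G L3194 (crit-1 g13): «FLOOR G (a) CONTENT IS MET IN SCRATCH — THEOREM ×1 PAYABLE ON LANDING booked under RULE K-R59 (ii) for the registered contingent head heightComparison : HeightComparison (hypothesis-free)»; p2: the TALLY moves to lens-1 ×23 + THEOREM ×25 at the critic's PORT IDENTITY of the LANDED head (until then lens-1 ×22 + THEOREM ×24); p3 (automatic, ×0): the K-line (β)-binder DISCHARGED — antecedents left PadicSubspace ∧ HeightOffAt m₀; node 12's THEOREMS A / B unconditional; census LIVENESS-v50 re-points the 13 conditional rows of v49 to reached BY NAME. Nothing here proves Schanuel, 33364, 33363, 31077 or 31987; rung 0; the THEOREM ×1 of RULE K-R59 (ii) is paid at the critic's PORT IDENTITY 31-G, not by this file.)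
-/

/-!
# RootDecomp1KSiegelFunctionsAll02 — lens 1, generation 71, NODE 31-G «`SiegelFunctionsAll` and the height binder `HeightComparison`
PROVED hypothesis-free» (FLOOR G (a) CONTENT of VERDICT 31 L3175 / ACK L3183; CLAIM 31-G L3188): PlanG v3 (HOME
decomp-schanuel-lens-1/g71/out/PlanG.lean, 727 l, sorry-free) on top of the landed record port `RootDecomp1KSiegelFunctions01–09`
(K 4f39c136…), split in three parts `…SiegelFunctionsAll01–03` (01 = S1/S6a CONSTRUCTION `CurveModel`/`SiegelModel`, `modelExists`, S2
`degYBound`, the statements `ModelExists`/`DegYBound`/`IntegralDegreeBound`, clearing of denominators; 02 = S5 `integralDegreeBound`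
(valuation-integrality ⇒ `K[g]`-coefficients of the minimal polynomial, `scaleRoots` comparison over `K(x) = K(1/x)`, transcendence degree
count); 03 = S6b `qdvd_relPoly_of_rel`, S3/S4 by the Literature Riemann inequality BY NAME, the compositions, and the hypothesis-free heads
`theorem siegelFunctionsAll : SiegelFunctionsAll`, `theorem heightComparison : …RootDecomp1KHeightGrading.HeightComparison`).
ONE namespace `Summit.Schanuel.Schanuel.Theorems.RootDecomp1KSiegelFunctions`; hygiene as the K port (NODE-g71.md §3c (iv)); three
instance ATTRIBUTES on the bundled-structure fields `CurveModel.instField/.instAlgebra/.instAFF` (part 01).  — part 02: S5 `integralDegreeBound`.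
-/

noncomputable section

namespace Summit.Schanuel.Schanuel.Theorems.RootDecomp1KSiegelFunctions

open Polynomial
open scoped Nat
open Summit.Schanuel.Schanuel.Theorems.RootDecomp1KDegreeLadder (bev xdeg natDegree_coeff_le_xdeg ThinFibreAt ThinFibre
  thinFibreAt_of_natDegree_lt)
open Summit.Schanuel.Schanuel.Theorems.RootDecomp1KHeightGrading

open Literature.NumberTheory.DiophantineGeometry
open Literature.NumberTheory.DiophantineGeometry.AlgFunctionField
open scoped IntermediateField

/-! #### S5 — `IntegralDegreeBound` PROVED (valuation-integrality + `scaleRoots` + transcendence degree count)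

Generic in the constant field `K` (characteristic `0` is used only for separability of `F/K(x)`). -/
section S5

variable {K : Type*} {F : Type*} [Field K] [Field F] [Algebra K F]

open IsDedekindDomain in
/-- Valuation-integral elements over `K[g]` have minimal polynomial over `E ⊇ K(g)` (with `E = Frac K[g]`)
with coefficients in `K[g]` (Stichtenoth Thm. 3.2.6; `K[X]` integrally closed). -/
theorem minpoly_map_eq_of_forall_mem [IsAlgFunctionField K F] [CharZero K]
    (E : IntermediateField K F) [FiniteDimensional E F] {g : F} (hg : Transcendental K g)
    (hgE : g ∈ E) (hfrac : ∀ z : E, ∃ r s : K[X], (z : F) = aeval g r / aeval g s) {θ : F}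
    (hθ : ∀ Q : PlaceOver K F, g ∈ Q.toValuationSubring → θ ∈ Q.toValuationSubring) :
    ∃ χ : K[X][X], χ.Monic ∧
      (minpoly E θ).map (algebraMap E F) = χ.map (aeval g : K[X] →ₐ[K] F).toRingHom := by
  classical
  set gE : E := ⟨g, hgE⟩ with hgE'
  letI algXF : Algebra K[X] F := (aeval g : K[X] →ₐ[K] F).toRingHom.toAlgebra
  letI algXE : Algebra K[X] E := (aeval gE : K[X] →ₐ[K] E).toRingHom.toAlgebra
  have halgF : ∀ p : K[X], algebraMap K[X] F p = aeval g p := fun p => rfl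
  have halgE : ∀ p : K[X], algebraMap K[X] E p = aeval gE p := fun p => rfl
  have hgalg : algebraMap E F gE = g := rfl
  have haevalE : ∀ p : K[X], algebraMap E F (aeval gE p) = aeval g p := fun p => by
    rw [← aeval_algebraMap_apply, hgalg]
  haveI : IsScalarTower K[X] E F := IsScalarTower.of_algebraMap_eq fun p => by
    rw [halgF, halgE, haevalE]
  haveI : IsScalarTower K K[X] F := IsScalarTower.of_algebraMap_eq fun c => by
    rw [halgF, Polynomial.algebraMap_eq, aeval_C]
  have hinjF : Function.Injective (algebraMap K[X] F) := by
    rw [injective_iff_map_eq_zero]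
    intro p hp
    rw [halgF] at hp
    by_contra hp0
    exact hg ⟨p, hp0, hp⟩
  haveI : FaithfulSMul K[X] F := (faithfulSMul_iff_algebraMap_injective _ _).2 hinjF
  have hgEt : Transcendental K gE := by
    intro h; apply hg
    have := h.algebraMap (A := F) (R := K) (S := E)
    exact this
  have hinjE : Function.Injective (algebraMap K[X] E) := by
    rw [injective_iff_map_eq_zero]
    intro p hp
    rw [halgE] at hp
    by_contra hp0
    exact hgEt ⟨p, hp0, hp⟩
  haveI : FaithfulSMul K[X] E := (faithfulSMul_iff_algebraMap_injective _ _).2 hinjE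
  haveI : IsFractionRing K[X] E := by
    refine IsFractionRing.of_field K[X] E fun z => ?_
    obtain ⟨r, s, hrs⟩ := hfrac z
    refine ⟨r, s, Subtype.ext ?_⟩
    rw [halgE, halgE, hrs]
    change aeval g r / aeval g s = algebraMap E F (aeval gE r / aeval gE s)
    rw [map_div₀, haevalE, haevalE]
  haveI : Algebra.IsSeparable E F := Algebra.IsSeparable.of_integral E F
  set B := integralClosure K[X] F with hB
  haveI hBD : IsDedekindDomain B := integralClosure.isDedekindDomain K[X] E F
  haveI hBF : IsFractionRing B F :=
    IsIntegralClosure.isFractionRing_of_finite_extension K[X] E F B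
  have key : θ ∈ (⊥ : Subalgebra B F) := by
    rw [← MaximalSpectrum.iInf_localization_eq_bot B F, Algebra.mem_iInf]
    intro 𝔐
    have hinjB : Function.Injective (algebraMap K[X] B) := fun x y h => hinjF (by
      have := congrArg (fun b : B => (b : F)) h
      exact this)
    have h𝔐 : 𝔐.asIdeal ≠ ⊥ := Ring.ne_bot_of_isMaximal_of_not_isField 𝔐.isMaximal fun hBf =>
      Polynomial.not_isField K (isField_of_isIntegral_of_isField hinjB hBf)
    set v : HeightOneSpectrum B := ⟨𝔐.asIdeal, 𝔐.isMaximal.isPrime, h𝔐⟩ with hv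
    set Q : PlaceOver K F := PlaceOver.ofPrime K F v with hQ
    have hgB : IsIntegral K[X] g := by
      have : g = algebraMap K[X] F X := by rw [halgF, aeval_X]
      rw [this]; exact isIntegral_algebraMap
    have hgQ : g ∈ Q.toValuationSubring := PlaceOver.algebraMap_mem_ofPrime v ⟨g, hgB⟩
    have hθQ := hθ Q hgQ
    rw [hQ, PlaceOver.mem_ofPrime_iff, ← Valuation.mem_valuationSubring_iff,
      ← HeightOneSpectrum.valuationSubringAtPrime_eq_valuationSubring] at hθQ
    exact hθQ
  obtain ⟨b, hb⟩ := Algebra.mem_bot.1 key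
  have hθint : IsIntegral K[X] θ := by
    have hbint : IsIntegral K[X] (b : F) := b.2
    rw [show (algebraMap B F b : F) = (b : F) from rfl] at hb
    rw [← hb]
    exact hbint
  refine ⟨minpoly K[X] θ, minpoly.monic hθint, ?_⟩
  rw [minpoly.isIntegrallyClosed_eq_field_fractions' E hθint, Polynomial.map_map,
    ← IsScalarTower.algebraMap_eq K[X] E F]
  rfl

section Main

variable [IsAlgFunctionField K F]

/-- `z ∈ ℒ(a (g)_∞)`, `z ≠ 0`: `ord_Q z ≥ -a · max(-ord_Q g, 0)` at every place. -/
theorem ord_bound_of_mem {g z : F} (hg0 : g ≠ 0) {a : ℕ}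
    (hz : z ∈ riemannRochSpace (a • (principalDivisor K g)⁻)) (hz0 : z ≠ 0) (Q : PlaceOver K F) :
    -((a : ℤ) * max (-Q.ord g) 0) ≤ Q.ord z := by
  have h := (Q.valuation_le_zpow_iff_le_ord hz0 _).1 ((mem_riemannRochSpace_iff _ _).1 hz Q)
  rwa [Finsupp.smul_apply, Divisor.negPart_apply, principalDivisor_apply_of_ne_zero hg0,
    nsmul_eq_mul] at h

-- PORT NOTE (census-1 g26): `omit … in` added — the section variable `[IsAlgFunctionField K F]` is unused in this lemma
-- (linter.unusedSectionVars would bounce the part); statement and proof = the lens's verbatim.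
omit [IsAlgFunctionField K F] in
/-- `z ≠ 0`, `ord_Q z ≥ 0` ⇒ `z ∈ 𝒪_Q`. -/
theorem mem_of_ord_nonneg {z : F} (hz0 : z ≠ 0) (Q : PlaceOver K F) (h : 0 ≤ Q.ord z) :
    z ∈ Q.toValuationSubring := by
  have := (Q.valuation_le_zpow_iff_le_ord hz0 0).2 h
  rw [zpow_zero] at this
  exact (Q.toValuationSubring.valuation_le_one_iff z).1 this

/-- `z ∈ ℒ(a (g)_∞)` is finite wherever `g` is. -/
theorem mem_of_mem_rRS {g z : F} (hg0 : g ≠ 0) {a : ℕ}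
    (hz : z ∈ riemannRochSpace (a • (principalDivisor K g)⁻)) (Q : PlaceOver K F)
    (hgQ : g ∈ Q.toValuationSubring) : z ∈ Q.toValuationSubring := by
  by_cases hz0 : z = 0
  · rw [hz0]; exact zero_mem _
  have h := ord_bound_of_mem hg0 hz hz0 Q
  have hg := Q.ord_nonneg_of_mem hgQ
  rw [max_eq_right (by omega), mul_zero, neg_zero] at h
  exact mem_of_ord_nonneg hz0 Q h

/-- `z ∈ ℒ(a (x)_∞)` ⇒ `z · x⁻ᵃ` is finite wherever `x⁻¹` is. -/
theorem mul_inv_pow_mem {x z : F} (hx0 : x ≠ 0) {a : ℕ}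
    (hz : z ∈ riemannRochSpace (a • (principalDivisor K x)⁻)) (Q : PlaceOver K F)
    (huQ : x⁻¹ ∈ Q.toValuationSubring) : z * x⁻¹ ^ a ∈ Q.toValuationSubring := by
  by_cases hz0 : z = 0
  · rw [hz0, zero_mul]; exact zero_mem _
  have h := ord_bound_of_mem hx0 hz hz0 Q
  have hu := Q.ord_nonneg_of_mem huQ
  rw [Q.ord_inv hx0] at hu
  rw [max_eq_left (by omega)] at h
  have hua : x⁻¹ ^ a ≠ 0 := pow_ne_zero _ (inv_ne_zero hx0)
  apply mem_of_ord_nonneg (mul_ne_zero hz0 hua) Q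
  rw [PlaceOver.ord_mul_holds Q hz0 hua, Q.ord_pow (inv_ne_zero hx0), Q.ord_inv hx0]
  linarith

omit [IsAlgFunctionField K F] in
/-- Degree extraction: if `p(x) · x⁻ᴺ = q(x⁻¹)` with `x` transcendental then `deg p ≤ N`. -/
theorem natDegree_le_of_rel {x : F} (hx : Transcendental K x) {p q : K[X]} {N : ℕ}
    (h : aeval x p * x⁻¹ ^ N = aeval x⁻¹ q) : p.natDegree ≤ N := by
  classical
  by_cases hp : p = 0
  · rw [hp, natDegree_zero]; exact Nat.zero_le _
  have hx0 : x ≠ 0 := fun h0 ↦ hx (h0 ▸ isAlgebraic_zero)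
  set e := q.natDegree with he
  set q' : K[X] := ∑ k ∈ Finset.range (e + 1), C (q.coeff k) * X ^ (e - k) with hq'
  have hq'deg : q'.natDegree ≤ e :=
    natDegree_sum_le_of_forall_le (Finset.range (e + 1)) (fun k ↦ C (q.coeff k) * X ^ (e - k))
      fun k _ ↦ (natDegree_C_mul_X_pow_le (q.coeff k) (e - k)).trans (Nat.sub_le e k)
  have hq'ev : aeval x q' = aeval x⁻¹ q * x ^ e := by
    rw [hq', map_sum, aeval_eq_sum_range x⁻¹, Finset.sum_mul]
    refine Finset.sum_congr rfl fun k hk ↦ ?_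
    have hke : k ≤ e := Nat.lt_succ_iff.1 (Finset.mem_range.1 hk)
    rw [map_mul, map_pow, aeval_C, aeval_X, Algebra.smul_def, mul_assoc]
    congr 1
    rw [← Nat.add_sub_cancel' hke, pow_add, Nat.add_sub_cancel_left, ← mul_assoc, inv_pow,
      inv_mul_cancel₀ (pow_ne_zero k hx0), one_mul]
  have h1 : aeval x p = aeval x⁻¹ q * x ^ N := by
    rw [← h, mul_assoc, inv_pow, inv_mul_cancel₀ (pow_ne_zero N hx0), mul_one]
  have h2 : aeval x (p * X ^ e) = aeval x (q' * X ^ N) := by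
    simp only [map_mul, map_pow, aeval_X, hq'ev, h1]; ring
  have h3 : p * X ^ e = q' * X ^ N := (transcendental_iff_injective.1 hx) h2
  have h4 : (p * X ^ e).natDegree = p.natDegree + e := natDegree_mul_X_pow (n := e) hp
  have h5 : (q' * X ^ N).natDegree ≤ e + N :=
    natDegree_mul_le.trans (by rw [natDegree_X_pow]; omega)
  rw [h3] at h4
  omega

/-- **S5 over a field of characteristic 0:** the integral elements of degree `≤ a` over `K[x]` satisfy a
monic relation over `K[x]` whose `i`-th coefficient has degree `≤ a i`. -/
theorem integralDegreeBound_field [CharZero K] {x : F} (hx : Transcendental K x) (a : ℕ) {z : F}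
    (hz : z ∈ riemannRochSpace (a • (principalDivisor K x)⁻)) :
    ∃ (m : ℕ) (χ : ℕ → K[X]), (∀ i, (χ i).natDegree ≤ a * i) ∧
      z ^ m + ∑ i ∈ Finset.Icc 1 m, aeval x (χ i) * z ^ (m - i) = 0 := by
  classical
  have hx0 : x ≠ 0 := fun h ↦ hx (h ▸ isAlgebraic_zero)
  set E := K⟮x⟯ with hE
  haveI : FiniteDimensional E F := IsAlgFunctionField.finiteDimensional_adjoin_simple hx
  set u := x⁻¹ with hu
  have hu0 : u ≠ 0 := inv_ne_zero hx0
  have hut : Transcendental K u := fun h ↦ hx (by simpa [hu] using h.inv)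
  have hxE : x ∈ E := IntermediateField.mem_adjoin_simple_self K x
  have huE : u ∈ E := inv_mem hxE
  have hfrac₁ : ∀ t : E, ∃ r s : K[X], (t : F) = aeval x r / aeval x s := fun t ↦
    (IntermediateField.mem_adjoin_simple_iff K t.1).1 t.2
  have hle : K⟮x⟯ ≤ K⟮u⟯ := IntermediateField.adjoin_simple_le_iff.2 (by
    rw [show x = u⁻¹ from (inv_inv x).symm]
    exact inv_mem (IntermediateField.mem_adjoin_simple_self K u))
  have hfrac₂ : ∀ t : E, ∃ r s : K[X], (t : F) = aeval u r / aeval u s := fun t ↦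
    (IntermediateField.mem_adjoin_simple_iff K t.1).1 (hle t.2)
  set w := z * u ^ a with hw
  obtain ⟨χ₁, hχ₁m, hχ₁⟩ := minpoly_map_eq_of_forall_mem E hx hxE hfrac₁ (θ := z)
    (fun Q hQ ↦ mem_of_mem_rRS hx0 hz Q hQ)
  obtain ⟨χ₂, hχ₂m, hχ₂⟩ := minpoly_map_eq_of_forall_mem E hut huE hfrac₂ (θ := w)
    (fun Q hQ ↦ mul_inv_pow_mem hx0 hz Q hQ)
  have hzint : IsIntegral E z := IsIntegral.of_finite E z
  have hwint : IsIntegral E w := IsIntegral.of_finite E w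
  set μ := minpoly E z with hμ
  set ν := minpoly E w with hν
  set xE : E := ⟨x, hxE⟩ with hxE'
  set cE : E := xE⁻¹ ^ a with hcE
  have hxEF : algebraMap E F xE = x := rfl
  have hcF : algebraMap E F cE = u ^ a := by rw [hcE, map_pow, map_inv₀, hxEF]
  have hcF' : algebraMap E F cE⁻¹ * w = z := by
    rw [map_inv₀, hcF, hw, mul_comm z, inv_mul_cancel_left₀ (pow_ne_zero a hu0)]
  have hν_dvd : ν ∣ μ.scaleRoots cE := minpoly.dvd E w (by
    have := scaleRoots_aeval_eq_zero (r := cE) (minpoly.aeval E z)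
    rwa [hcF, mul_comm, ← hw] at this)
  have hμ_dvd : μ ∣ ν.scaleRoots cE⁻¹ := minpoly.dvd E z (by
    have := scaleRoots_aeval_eq_zero (r := cE⁻¹) (minpoly.aeval E w)
    rwa [hcF'] at this)
  have hμm : μ.Monic := minpoly.monic hzint
  have hνm : ν.Monic := minpoly.monic hwint
  have hdeg : (μ.scaleRoots cE).natDegree ≤ ν.natDegree := by
    rw [natDegree_scaleRoots]
    calc μ.natDegree ≤ (ν.scaleRoots cE⁻¹).natDegree :=
          natDegree_le_of_dvd hμ_dvd ((monic_scaleRoots_iff _).2 hνm).ne_zero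
      _ = ν.natDegree := natDegree_scaleRoots _ _
  have hνeq : μ.scaleRoots cE = ν :=
    eq_of_monic_of_dvd_of_natDegree_le hνm ((monic_scaleRoots_iff cE).2 hμm) hν_dvd hdeg
  set m := μ.natDegree with hm
  have hc₁ : ∀ i, algebraMap E F (μ.coeff i) = aeval x (χ₁.coeff i) := fun i ↦ by
    have := congrArg (fun p ↦ Polynomial.coeff p i) hχ₁
    simp only [Polynomial.coeff_map] at this
    exact this
  have hc₂ : ∀ i, algebraMap E F (ν.coeff i) = aeval u (χ₂.coeff i) := fun i ↦ by
    have := congrArg (fun p ↦ Polynomial.coeff p i) hχ₂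
    simp only [Polynomial.coeff_map] at this
    exact this
  have hrel : ∀ i, aeval x (χ₁.coeff i) * u ^ (a * (m - i)) = aeval u (χ₂.coeff i) := fun i ↦ by
    rw [← hc₁, ← hc₂, ← hνeq, coeff_scaleRoots, map_mul, map_pow, hcF, ← pow_mul]
  have hχ₁deg : χ₁.natDegree = m := by
    have := congrArg Polynomial.natDegree hχ₁
    rwa [Polynomial.natDegree_map_eq_of_injective (algebraMap E F).injective, hχ₁m.natDegree_map,
      eq_comm] at this
  refine ⟨m, fun j ↦ χ₁.coeff (m - j), fun j ↦ ?_, ?_⟩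
  · have h := natDegree_le_of_rel hx (hrel (m - j))
    exact h.trans (Nat.mul_le_mul_left _ (by omega))
  · have h0 : aeval z μ = 0 := minpoly.aeval E z
    rw [aeval_def, eval₂_eq_eval_map, hχ₁, eval_map,
      eval₂_eq_sum_range' (aeval x : K[X] →ₐ[K] F).toRingHom (n := m + 1) (x := z)
        (by rw [hχ₁deg]; exact Nat.lt_succ_self m),
      Finset.sum_range_succ, show χ₁.coeff m = 1 by rw [← hχ₁deg]; exact hχ₁m.coeff_natDegree,
      map_one, one_mul] at h0
    rw [add_comm, ← h0]
    congr 1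
    refine Finset.sum_nbij' (fun j ↦ m - j) (fun i ↦ m - i) ?_ ?_ ?_ ?_ ?_
    · intro j hj; simp only [Finset.mem_Icc, Finset.mem_range] at hj ⊢; omega
    · intro i hi; simp only [Finset.mem_Icc, Finset.mem_range] at hi ⊢; omega
    · intro j hj; simp only [Finset.mem_Icc] at hj; omega
    · intro i hi; simp only [Finset.mem_range] at hi; omega
    · intro j hj; rfl

end Main

end S5

/-- clearing denominators, one variable — PORT NOTE (census-1 g26): a PRIVATE copy of part 01's `exists_map_eq_C_mul` (privatised there after
the `dedup.landed` dry-run notice against `Literature.NumberTheory.LFunctions.WeilFatou.exists_int_map_eq_C_mul`) for its one use in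
`integralDegreeBound` below; same statement and proof as the lens's; private names do not cross part boundaries. -/
private theorem exists_map_eq_C_mul (q : ℚ[X]) :
    ∃ (N : ℤ) (q' : ℤ[X]), N ≠ 0 ∧ q'.map (Int.castRingHom ℚ) = C (N : ℚ) * q := by
  induction q using Polynomial.induction_on' with
  | add p r hp hr =>
    obtain ⟨N₁, p', h1, hp'⟩ := hp
    obtain ⟨N₂, r', h2, hr'⟩ := hr
    refine ⟨N₁ * N₂, C N₂ * p' + C N₁ * r', mul_ne_zero h1 h2, ?_⟩
    rw [Polynomial.map_add, Polynomial.map_mul, Polynomial.map_mul, hp', hr', Polynomial.map_C, Polynomial.map_C,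
      eq_intCast, eq_intCast, Int.cast_mul, C_mul]
    ring
  | monomial n c =>
    refine ⟨c.den, monomial n c.num, by exact_mod_cast c.den_pos.ne', ?_⟩
    rw [Polynomial.map_monomial, eq_intCast, Int.cast_natCast, C_mul_monomial, Rat.den_mul_eq_num]

/-- **S5 (PROVED)** — `IntegralDegreeBound`: integrality over `ℚ[x]` of the elements of `ℒ(a·(x)_∞)` with the degree
bound `deg χ_i ≤ a·i` on the coefficients of the monic relation, denominators cleared to `ℤ[x]`.  Proof: the minimal
polynomial of `z` over `E = ℚ(x)` has coefficients in `ℚ[x]` (valuation-integrality at the finite places of `x` +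
`ℚ[x]` integrally closed + the integral closure of `ℚ[x]` in `F` is Dedekind and the intersection of its localisations,
`minpoly_map_eq_of_forall_mem`), the same for `w = z·x^{-a}` over `ℚ[1/x]`; `minpoly_E w = scaleRoots (minpoly_E z) x^{-a}`
compares the two coefficient systems (`χ_i(x)·x^{-a(m-i)} ∈ ℚ[1/x]`), and transcendence of `x` turns that into the degree
bound (`natDegree_le_of_rel`); finally one common denominator `D`. -/
theorem integralDegreeBound : IntegralDegreeBound := by
  intro F _ _ _ x₀ hx a z hz
  classical
  obtain ⟨m, χ, hdeg, hrel⟩ := integralDegreeBound_field hx a hz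
  choose N χ' hN hχ' using fun i ↦ exists_map_eq_C_mul (χ i)
  set S := Finset.Icc 1 m with hS
  set D : ℤ := ∏ i ∈ S, N i with hD
  have hD0 : D ≠ 0 := Finset.prod_ne_zero_iff.2 fun i _ ↦ hN i
  refine ⟨m, D, fun i ↦ C (∏ j ∈ S.erase i, N j) * χ' i, hD0, fun i ↦ ?_, ?_⟩
  · refine (natDegree_C_mul_le _ _).trans ?_
    rw [← natDegree_map_eq_of_injective (Int.castRingHom ℚ).injective_int (χ' i), hχ',
      natDegree_C_mul (Int.cast_ne_zero.2 (hN i))]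
    exact hdeg i
  · have hterm : ∀ i ∈ S, aeval x₀ ((C (∏ j ∈ S.erase i, N j) * χ' i).map (Int.castRingHom ℚ)) =
        (D : F) * aeval x₀ (χ i) := fun i hi ↦ by
      rw [Polynomial.map_mul, Polynomial.map_C, hχ', ← mul_assoc, ← C_mul, eq_intCast, ← Int.cast_mul,
        Finset.prod_erase_mul _ _ hi, map_mul, aeval_C, map_intCast]
    rw [Finset.sum_congr rfl fun i hi ↦ by rw [hterm i hi, mul_assoc], ← Finset.mul_sum, ← mul_add, hrel,
      mul_zero]

end Summit.Schanuel.Schanuel.Theorems.RootDecomp1KSiegelFunctions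

end
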